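import Mathlib
import Summits.Ventures.Crystal3D.Theorems.StickyWulffConstantTextureLiminfTentCells
import HarnessLib

/-!
# The tent certificate for fcc grains — facet planes of the chambers (eng g8)

Route `StickyWulffConstant` (`Summits/Ventures/Crystal3D`, cell `crystal3d-full`), support toward the crux
`TextureLiminf` (stmt-Ventures-19483), FREE half (tent certificate, TexShadow v6.1), the POLYTOPE clause of
`BarlowFreeCertificate` in the cubic frame: at a generic level `t` the super-level set `{f_X > t}` is, up
to a null set (cell boundaries), the disjoint union of the open convex pieces `cell ∩ {affine > t}`, each
an open H-polytope (`TexShadow.polytope`) with UNIT normals and pairwise DISTINCT facet planes, inside its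
cell (hence inside one bilayer slab).
* `plane_eq_imp_smul` — equal planes have proportional data;
* `pairwise_plane_ne_chamberH` — the fourteen facet planes of a chamber are pairwise distinct
(this file); the pieces themselves are in `…TentPieces.lean`.
WHAT THIS IS NOT: the certificate; F-C1 not moved.
-/

noncomputable section

namespace Summit.Ventures.Crystal3D.TentCertificate

open Finset Summit.Ventures.Crystal3D MeasureTheory
open Literature.Geometry.DiscreteGeometry (intVec intVec_apply)
open scoped RealInnerProductSpace

/-! ## Planes -/

/-- **Equal planes have proportional data** (`a ≠ 0`). -/
theorem plane_eq_imp_smul {a a' : EuclideanSpace ℝ (Fin 3)} {c c' : ℝ} (ha : a ≠ 0)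
    (h : {x : EuclideanSpace ℝ (Fin 3) | ⟪a, x⟫ = c} = {x | ⟪a', x⟫ = c'}) :
    ∃ μ : ℝ, a' = μ • a ∧ c' = μ * c := by
  have ha2 : ⟪a, a⟫ ≠ 0 := by rw [real_inner_self_eq_norm_sq]; positivity
  set x₀ : EuclideanSpace ℝ (Fin 3) := (c / ⟪a, a⟫) • a with hx₀
  have hx₀P : ⟪a, x₀⟫ = c := by rw [hx₀, real_inner_smul_right]; field_simp
  have hmem : ∀ x, ⟪a, x⟫ = c → ⟪a', x⟫ = c' := fun x hx => by
    have : x ∈ {x : EuclideanSpace ℝ (Fin 3) | ⟪a, x⟫ = c} := hx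
    rw [h] at this; exact this
  have h0 : ⟪a', x₀⟫ = c' := hmem x₀ hx₀P
  -- `a'` kills every vector orthogonal to `a`
  have hperp : ∀ v, ⟪a, v⟫ = 0 → ⟪a', v⟫ = 0 := by
    intro v hv
    have := hmem (x₀ + v) (by rw [inner_add_right, hx₀P, hv, add_zero])
    rw [inner_add_right, h0] at this; linarith
  set μ : ℝ := ⟪a, a'⟫ / ⟪a, a⟫ with hμ
  set w : EuclideanSpace ℝ (Fin 3) := a' - μ • a with hw
  have hwa : ⟪a, w⟫ = 0 := by rw [hw, inner_sub_right, real_inner_smul_right, hμ]; field_simp; ring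
  have hw0 : w = 0 := by
    have h1 := hperp w hwa
    have h2 : ⟪w, w⟫ = 0 := by
      have ha' : a' = w + μ • a := by rw [hw]; abel
      have : ⟪a', w⟫ = ⟪w, w⟫ + μ * ⟪a, w⟫ := by
        rw [ha', inner_add_left, real_inner_smul_left]
      rw [this, hwa, mul_zero, add_zero] at h1; exact h1
    exact inner_self_eq_zero.1 h2
  refine ⟨μ, by rw [← sub_eq_zero, ← hw, hw0], ?_⟩
  rw [← h0, show a' = μ • a by rw [← sub_eq_zero, ← hw, hw0], real_inner_smul_left, hx₀P]

/-- Scaling the data by a nonzero factor does not change the plane. -/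
theorem plane_smul_eq {a : EuclideanSpace ℝ (Fin 3)} {c μ : ℝ} (hμ : μ ≠ 0) :
    {x : EuclideanSpace ℝ (Fin 3) | ⟪μ • a, x⟫ = μ * c} = {x | ⟪a, x⟫ = c} := by
  ext x; simp only [Set.mem_setOf_eq, real_inner_smul_left]
  constructor
  · intro h; exact mul_left_cancel₀ hμ h
  · intro h; rw [h]

/-- Scaling the data by a positive factor does not change the open half-space. -/
theorem halfSpace_smul_eq {a : EuclideanSpace ℝ (Fin 3)} {c μ : ℝ} (hμ : 0 < μ) :
    {x : EuclideanSpace ℝ (Fin 3) | ⟪μ • a, x⟫ < μ * c} = {x | ⟪a, x⟫ < c} := by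
  ext x; simp only [Set.mem_setOf_eq, real_inner_smul_left]
  exact ⟨fun h => lt_of_mul_lt_mul_left h hμ.le, fun h => mul_lt_mul_of_pos_left h hμ⟩

/-! ## The facet planes of a chamber are pairwise distinct -/

/-- Membership in `chamberH`, unfolded. -/
theorem mem_chamberH_iff {k : Fin 3 → ℤ} {m : Fin 4 → ℤ} {q : EuclideanSpace ℝ (Fin 3) × ℝ} :
    q ∈ chamberH k m ↔
      (∃ i : Fin 3, q = (Real.sqrt 2 • EuclideanSpace.single i (1 : ℝ), (k i : ℝ) + 1)) ∨
      (∃ i : Fin 3, q = (-(Real.sqrt 2 • EuclideanSpace.single i (1 : ℝ)), -(k i : ℝ))) ∨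
      (∃ j : Fin 4, q = (Real.sqrt 2 • intVec (normal4 j), 2 * (m j : ℝ) + 2)) ∨
      (∃ j : Fin 4, q = (-(Real.sqrt 2 • intVec (normal4 j)), -(2 * (m j : ℝ)))) := by
  simp only [chamberH, Finset.mem_union, Finset.mem_image, Finset.mem_univ, true_and, eq_comm, or_assoc]

/-- The eight direction vectors (up to sign): `e_i` and `a_j`, as integer vectors. -/
theorem chamberH_fst_eq {k : Fin 3 → ℤ} {m : Fin 4 → ℤ} {q : EuclideanSpace ℝ (Fin 3) × ℝ}
    (hq : q ∈ chamberH k m) :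
    ∃ (σ : ℝ) (n : Fin 3 → ℤ), (σ = 1 ∨ σ = -1) ∧ q.1 = (σ * Real.sqrt 2) • intVec n ∧
      ((∃ i : Fin 3, n = Pi.single i 1 ∧ q.2 = σ * (k i + (1 + σ) / 2)) ∨
       (∃ j : Fin 4, n = normal4 j ∧ q.2 = σ * (2 * m j + (1 + σ)))) := by
  have hsingle : ∀ i : Fin 3, EuclideanSpace.single i (1 : ℝ) = intVec (Pi.single i 1) := by
    intro i; ext l
    rcases eq_or_ne l i with rfl | h
    · simp [intVec_apply]
    · simp [intVec_apply, h]
  rcases mem_chamberH_iff.1 hq with ⟨i, rfl⟩ | ⟨i, rfl⟩ | ⟨j, rfl⟩ | ⟨j, rfl⟩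
  · exact ⟨1, Pi.single i 1, Or.inl rfl, by rw [one_mul, hsingle], Or.inl ⟨i, rfl, by ring⟩⟩
  · exact ⟨-1, Pi.single i 1, Or.inr rfl, by rw [hsingle, neg_one_mul, neg_smul], Or.inl ⟨i, rfl, by ring⟩⟩
  · exact ⟨1, normal4 j, Or.inl rfl, by rw [one_mul], Or.inr ⟨j, rfl, by ring⟩⟩
  · exact ⟨-1, normal4 j, Or.inr rfl, by rw [neg_one_mul, neg_smul], Or.inr ⟨j, rfl, by ring⟩⟩

/-- Proportional direction vectors among `{e_i} ∪ {a_j}` are equal, with factor `±1` matching signs. -/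
theorem dirs_eq_of_smul {σ σ' μ : ℝ} (hσ : σ = 1 ∨ σ = -1) (hσ' : σ' = 1 ∨ σ' = -1) {n n' : Fin 3 → ℤ}
    (hn : (∃ i : Fin 3, n = Pi.single i 1) ∨ ∃ j : Fin 4, n = normal4 j)
    (hn' : (∃ i : Fin 3, n' = Pi.single i 1) ∨ ∃ j : Fin 4, n' = normal4 j)
    (h : (σ' * Real.sqrt 2) • intVec n' = μ • ((σ * Real.sqrt 2) • intVec n)) :
    n = n' ∧ μ = σ * σ' := by
  have hs : (0 : ℝ) < Real.sqrt 2 := by positivity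
  -- compare coordinates
  have hc : ∀ l : Fin 3, σ' * (n' l : ℝ) = μ * σ * (n l : ℝ) := by
    intro l
    have := congrArg (fun v : EuclideanSpace ℝ (Fin 3) => v l) h
    simp only [PiLp.smul_apply, smul_eq_mul, intVec_apply, smul_smul] at this
    have h2 : Real.sqrt 2 * (σ' * (n' l : ℝ)) = Real.sqrt 2 * (μ * σ * (n l : ℝ)) := by linarith [this]
    exact mul_left_cancel₀ hs.ne' h2
  have hσ2 : σ * σ = 1 := by rcases hσ with rfl | rfl <;> norm_num
  have hσ'2 : σ' * σ' = 1 := by rcases hσ' with rfl | rfl <;> norm_num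
  -- integer coordinates of the candidates
  have key : ∀ l : Fin 3, (n' l : ℝ) = (μ * σ * σ') * (n l : ℝ) := by
    intro l; have := hc l
    calc (n' l : ℝ) = σ' * (σ' * (n' l : ℝ)) := by rw [← mul_assoc, hσ'2, one_mul]
      _ = (μ * σ * σ') * (n l : ℝ) := by rw [this]; ring
  set ν : ℝ := μ * σ * σ' with hν
  -- case analysis on the two candidates
  have hμ : μ = ν * (σ * σ') := by
    rw [hν]; calc μ = μ * (σ * σ) * (σ' * σ') := by rw [hσ2, hσ'2]; ring
      _ = μ * σ * σ' * (σ * σ') := by ring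
  suffices hνn : ν = 1 ∧ n = n' by
    refine ⟨hνn.2, ?_⟩; rw [hμ, hνn.1, one_mul]
  rcases hn with ⟨i, rfl⟩ | ⟨j, rfl⟩ <;> rcases hn' with ⟨i', rfl⟩ | ⟨j', rfl⟩
  · have h1 := key i; have h2 := key i'
    by_cases hii : i = i'
    · subst hii; simp at h1; exact ⟨h1.symm, rfl⟩
    · exfalso; simp [hii, Ne.symm hii] at h1 h2
  · exfalso
    have h1 := key i
    obtain ⟨l, hl⟩ : ∃ l : Fin 3, l ≠ i := by
      fin_cases i
      · exact ⟨1, by decide⟩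
      · exact ⟨0, by decide⟩
      · exact ⟨0, by decide⟩
    have h2 := key l
    simp [hl] at h2
    have : normal4 j' l ≠ 0 := by fin_cases j' <;> fin_cases l <;> simp [normal4]
    exact this h2
  · exfalso
    obtain ⟨l, hl⟩ : ∃ l : Fin 3, l ≠ i' := by
      fin_cases i'
      · exact ⟨1, by decide⟩
      · exact ⟨0, by decide⟩
      · exact ⟨0, by decide⟩
    have h2 := key l
    simp [hl] at h2
    rcases h2 with h2 | h2
    · -- ν = 0 forces n' i' = 0
      have h3 := key i'
      simp [h2] at h3
    · have : normal4 j l ≠ 0 := by fin_cases j <;> fin_cases l <;> simp [normal4]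
      exact this h2
  · have h0 := key 0; have h1 := key 1; have h2 := key 2
    fin_cases j <;> fin_cases j' <;> simp [normal4] at h0 h1 h2 ⊢ <;> first | exact h0.symm | linarith

/-- **The fourteen facet planes of a chamber are pairwise distinct.** -/
theorem pairwise_plane_ne_chamberH (k : Fin 3 → ℤ) (m : Fin 4 → ℤ) {q q' : EuclideanSpace ℝ (Fin 3) × ℝ}
    (hq : q ∈ chamberH k m) (hq' : q' ∈ chamberH k m) (hne : q ≠ q') :
    {x : EuclideanSpace ℝ (Fin 3) | ⟪q.1, x⟫ = q.2} ≠ {x | ⟪q'.1, x⟫ = q'.2} := by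
  intro heq
  obtain ⟨σ, n, hσ, hq1, hq2⟩ := chamberH_fst_eq hq
  obtain ⟨σ', n', hσ', hq1', hq2'⟩ := chamberH_fst_eq hq'
  have hs : (0 : ℝ) < Real.sqrt 2 := by positivity
  have hn0 : intVec n ≠ (0 : EuclideanSpace ℝ (Fin 3)) := by
    rcases hq2 with ⟨i, rfl, -⟩ | ⟨j, rfl, -⟩
    · intro h; have := congrArg (fun v : EuclideanSpace ℝ (Fin 3) => v i) h; simp [intVec_apply] at this
    · intro h; have := congrArg (fun v : EuclideanSpace ℝ (Fin 3) => v 0) h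
      fin_cases j <;> simp [intVec_apply, normal4] at this
  have hq10 : q.1 ≠ 0 := by
    rw [hq1]; intro h
    rw [smul_eq_zero] at h
    rcases h with h | h
    · rcases hσ with rfl | rfl <;> simp at h
    · exact hn0 h
  obtain ⟨μ, hμ1, hμ2⟩ := plane_eq_imp_smul hq10 heq
  rw [hq1, hq1'] at hμ1
  have hdir := dirs_eq_of_smul hσ hσ' (hq2.imp (fun ⟨i, h, _⟩ => ⟨i, h⟩) (fun ⟨j, h, _⟩ => ⟨j, h⟩))
    (hq2'.imp (fun ⟨i, h, _⟩ => ⟨i, h⟩) (fun ⟨j, h, _⟩ => ⟨j, h⟩)) hμ1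
  obtain ⟨hnn, hμ⟩ := hdir
  have hσ2 : σ * σ = 1 := by rcases hσ with rfl | rfl <;> norm_num
  -- same direction: compare the levels; `σ = σ'` gives `q = q'`, `σ = -σ'` contradicts the levels
  apply hne
  rcases hq2 with ⟨i, hni, hc⟩ | ⟨j, hnj, hc⟩ <;> rcases hq2' with ⟨i', hni', hc'⟩ | ⟨j', hnj', hc'⟩
  · have hii : i = i' := by
      have := congrArg (fun f : Fin 3 → ℤ => f i) (hni.symm.trans (hnn.trans hni'))
      by_contra hii; simp [hii] at this
    subst hii
    rw [hc, hμ] at hμ2; rw [hc'] at hμ2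
    rcases hσ with rfl | rfl <;> rcases hσ' with rfl | rfl
    · exact Prod.ext (by rw [hq1, hq1', hnn]) (by rw [hc, hc'])
    · exfalso; norm_num at hμ2
    · exfalso; norm_num at hμ2
    · exact Prod.ext (by rw [hq1, hq1', hnn]) (by rw [hc, hc'])
  · exfalso
    have := congrArg (fun f : Fin 3 → ℤ => f) (hni.symm.trans (hnn.trans hnj'))
    obtain ⟨l, hl⟩ : ∃ l : Fin 3, l ≠ i := by
      fin_cases i
      · exact ⟨1, by decide⟩
      · exact ⟨0, by decide⟩
      · exact ⟨0, by decide⟩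
    have h2 := congrArg (fun f : Fin 3 → ℤ => f l) this
    simp [hl] at h2
    fin_cases j' <;> fin_cases l <;> simp [normal4] at h2
  · exfalso
    have := hni'.symm.trans (hnn.symm.trans hnj)
    obtain ⟨l, hl⟩ : ∃ l : Fin 3, l ≠ i' := by
      fin_cases i'
      · exact ⟨1, by decide⟩
      · exact ⟨0, by decide⟩
      · exact ⟨0, by decide⟩
    have h2 := congrArg (fun f : Fin 3 → ℤ => f l) this
    simp [hl] at h2
    fin_cases j <;> fin_cases l <;> simp [normal4] at h2
  · have hjj : j = j' := by
      have := hnj.symm.trans (hnn.trans hnj')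
      by_contra hjj
      fin_cases j <;> fin_cases j' <;> first | exact hjj rfl |
        (have h0 := congrArg (fun f : Fin 3 → ℤ => f 0) this;
         have h1 := congrArg (fun f : Fin 3 → ℤ => f 1) this;
         have h2 := congrArg (fun f : Fin 3 → ℤ => f 2) this;
         simp [normal4] at h0 h1 h2)
    subst hjj
    rw [hc, hμ] at hμ2; rw [hc'] at hμ2
    rcases hσ with rfl | rfl <;> rcases hσ' with rfl | rfl
    · exact Prod.ext (by rw [hq1, hq1', hnn]) (by rw [hc, hc'])
    · exfalso; norm_num at hμ2
    · exfalso; norm_num at hμ2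
    · exact Prod.ext (by rw [hq1, hq1', hnn]) (by rw [hc, hc'])


end Summit.Ventures.Crystal3D.TentCertificate

end
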